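import Mathlib
import Summits.MatrixMultiplication.MatrixMultiplication.Theorems.SubgroupIdentityDesigns.Negative.EndPlacements
import Summits.MatrixMultiplication.MatrixMultiplication.Theorems.SubgroupIdentityDesigns.Negative.MiddleTorus
import Summits.MatrixMultiplication.MatrixMultiplication.Theorems.SubgroupIdentityDesigns.Negative.SLMemberLaw

/-!
# The `p`-member law (all primes `p ≥ 5`): a level-one witness has `p`-free members

Route `LevelGradedCohnUmans`, crux `SubgroupIdentityDesigns`, the `(m,k) = (2,1)` cell.

**Dichotomy** (`SL_or_borel_of_dvd`, Sylow theory of `GL₂(𝔽_p)` made explicit): if `p ∣ |H|`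
then either `SL₂(𝔽_p) ≤ H`, or `H` is conjugate to a subgroup `K` with `U⁺ ≤ K ≤ B⁺`.
Proof: an element of order `p` is conjugate into `U⁺`, which then lies in the conjugate `L` of
`H` (`Transvections.upper_le_map_conj`); if some `k ∈ L` has `k₁₀ ≠ 0` the root lemma
(`Transvections.lower_mem_of_upper_mem`) puts `U⁻ ≤ L`, and `U⁺, U⁻` generate `SL₂`
(`SL_le_of_unipotents`: `x = E₁₂(s)·E₂₁(x₁₀)·E₁₂(t)` when `x₁₀ ≠ 0`).

**Consequence** (`no_levelOne_witness_of_dvd₁/₂/₃`, `coprime_of_levelOne_witness`): combining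
the `SL₂`-member law (`SLMemberLaw`, `p ≥ 3`), the end laws (`EndPlacements`, `p ≥ 5`) and the
middle law (`MiddleTorus`, `p ≥ 5`): for every prime `p ≥ 5` and every `0 < ε ≤ 1`, a
subgroup-TPP triple of `GL₂(𝔽_p)` carrying a level-`1` identity design and satisfying the crux
inequality `budget < (|H₁||H₂||H₃|)^{(2+ε)/3}` has ALL THREE members of order prime to `p`.

So the `(2,1)` cell of the crux is reduced, for `p ≥ 5`, to `p`-FREE triples (where the census
finds volumes above the floor — `p = 5`: max `2250 > 864`·… see the route notes — but no design by
exact test at `p = 5, 7`), and to `p = 3`.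
VALUE = THEOREM (all `p ≥ 5`), NOT summit progress; the crux item stmt-MatrixMultiplication-14079
is untouched and remains open.
-/

set_option linter.dupNamespace false

noncomputable section

open scoped BigOperators Classical

open Summit.MatrixMultiplication.MatrixMultiplication.Theorems.LieRankDesigns.Negative
  (GLm Mat fourierFn budget)
open Summit.MatrixMultiplication.MatrixMultiplication.Theorems.LevelOneGL2Designs.Negative
  (levelSubmodule fourierFn_mem_levelSubmodule)

namespace Summit.MatrixMultiplication.MatrixMultiplication.Theorems.SubgroupIdentityDesigns.Negative

section PMemberLaw

open Literature.Barriers.MatrixMultiplication (SubgroupTPP)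

variable {p : ℕ} [hp : Fact p.Prime]

/-- `E₁₂(s)·E₂₁(c)·E₁₂(t)`: an element of determinant one with `x₁₀ ≠ 0` lies in any subgroup
containing `U⁺` and `U⁻`. -/
theorem mem_of_det_one_of_ne {L : Subgroup (GLm p 2)}
    (hU : ∀ u : GLm p 2, (u : Mat p 2) 1 0 = 0 → (u : Mat p 2) 0 0 = 1 → (u : Mat p 2) 1 1 = 1 →
      u ∈ L)
    (hL : ∀ u : GLm p 2, (u : Mat p 2) 0 1 = 0 → (u : Mat p 2) 0 0 = 1 → (u : Mat p 2) 1 1 = 1 →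
      u ∈ L)
    {x : GLm p 2} (hdet : (x : Mat p 2).det = 1) (hc : (x : Mat p 2) 1 0 ≠ 0) : x ∈ L := by
  have had : (x : Mat p 2) 0 0 * (x : Mat p 2) 1 1 - (x : Mat p 2) 0 1 * (x : Mat p 2) 1 0 = 1 := by
    rw [← Matrix.det_fin_two]; exact hdet
  obtain ⟨u₁, a00, a01, a10, a11⟩ :=
    exists_gl2 (1 : ZMod p) (((x : Mat p 2) 0 0 - 1) / (x : Mat p 2) 1 0) 0 1 (by simp)
  obtain ⟨l, b00, b01, b10, b11⟩ := exists_gl2 (1 : ZMod p) 0 ((x : Mat p 2) 1 0) 1 (by simp)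
  obtain ⟨u₂, c00, c01, c10, c11⟩ :=
    exists_gl2 (1 : ZMod p) (((x : Mat p 2) 1 1 - 1) / (x : Mat p 2) 1 0) 0 1 (by simp)
  have key : x = u₁ * l * u₂ := by
    apply gl2_ext <;>
      simp only [gl2_mul_apply, a00, a01, a10, a11, b00, b01, b10, b11, c00, c01, c10, c11]
    · field_simp
      ring
    · field_simp
      linear_combination -had
    · ring
    · field_simp
      ring
  rw [key]
  exact L.mul_mem (L.mul_mem (hU u₁ a10 a00 a11) (hL l b01 b00 b11)) (hU u₂ c10 c00 c11)

/-- **`U⁺` and `U⁻` generate `SL₂(𝔽_p)`**: a subgroup containing both unitriangular groups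
contains every element of determinant one. -/
theorem SL_le_of_unipotents {L : Subgroup (GLm p 2)}
    (hU : ∀ u : GLm p 2, (u : Mat p 2) 1 0 = 0 → (u : Mat p 2) 0 0 = 1 → (u : Mat p 2) 1 1 = 1 →
      u ∈ L)
    (hL : ∀ u : GLm p 2, (u : Mat p 2) 0 1 = 0 → (u : Mat p 2) 0 0 = 1 → (u : Mat p 2) 1 1 = 1 →
      u ∈ L)
    (x : GLm p 2) (hdet : Matrix.GeneralLinearGroup.det x = 1) : x ∈ L := by
  have hd : (x : Mat p 2).det = 1 := by
    have e := congrArg Units.val hdet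
    rwa [Matrix.GeneralLinearGroup.val_det_apply, Units.val_one] at e
  by_cases hc : (x : Mat p 2) 1 0 = 0
  · have had : (x : Mat p 2) 0 0 * (x : Mat p 2) 1 1 - (x : Mat p 2) 0 1 * (x : Mat p 2) 1 0 = 1 :=
      by rw [← Matrix.det_fin_two]; exact hd
    have ha : (x : Mat p 2) 0 0 ≠ 0 := by
      intro h0
      rw [h0, hc, zero_mul, mul_zero, sub_zero] at had
      exact zero_ne_one had
    obtain ⟨l₁, d00, d01, d10, d11⟩ := exists_gl2 (1 : ZMod p) 0 1 1 (by simp)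
    have hl₁ : l₁ ∈ L := hL l₁ d01 d00 d11
    have h10 : ((l₁ * x : GLm p 2) : Mat p 2) 1 0 ≠ 0 := by
      rw [gl2_mul_apply, d10, d11, hc, one_mul, mul_zero, add_zero]; exact ha
    have hdet' : ((l₁ * x : GLm p 2) : Mat p 2).det = 1 := by
      rw [Units.val_mul, Matrix.det_mul, hd, mul_one, Matrix.det_fin_two, d00, d01, d10, d11]
      ring
    have hx' := mem_of_det_one_of_ne hU hL hdet' h10
    have e : x = l₁⁻¹ * (l₁ * x) := by group
    rw [e]
    exact L.mul_mem (L.inv_mem hl₁) hx'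
  · exact mem_of_det_one_of_ne hU hL hd hc

/-- **DICHOTOMY FOR `p`-MEMBERS** (Sylow theory of `GL₂(𝔽_p)`): if `p ∣ |H|` then either
`SL₂(𝔽_p) ≤ H`, or some conjugate `g⁻¹ H g` satisfies `U⁺ ≤ g⁻¹ H g ≤ B⁺`. -/
theorem SL_or_borel_of_dvd {H : Subgroup (GLm p 2)} (hdvd : p ∣ Nat.card H) :
    (∀ x : GLm p 2, Matrix.GeneralLinearGroup.det x = 1 → x ∈ H) ∨
      ∃ g : GLm p 2, (∀ k ∈ H.map (MulAut.conj g⁻¹).toMonoidHom, (k : Mat p 2) 1 0 = 0) ∧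
        ∀ u : GLm p 2, (u : Mat p 2) 1 0 = 0 → (u : Mat p 2) 0 0 = 1 → (u : Mat p 2) 1 1 = 1 →
          u ∈ H.map (MulAut.conj g⁻¹).toMonoidHom := by
  obtain ⟨g, hg, hg1, hdet, v, hv, hfix⟩ := exists_transvection hdvd
  obtain ⟨z, z00, z10⟩ := exists_gl2_col hv
  have hU := upper_le_map_conj hg hg1 hdet (by rw [z00, z10]; exact hfix.1)
    (by rw [z00, z10]; exact hfix.2)
  by_cases hB : ∀ k ∈ H.map (MulAut.conj z⁻¹).toMonoidHom, (k : Mat p 2) 1 0 = 0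
  · exact Or.inr ⟨z, hB, hU⟩
  · left
    push Not at hB
    obtain ⟨k, hk, hk10⟩ := hB
    have hLow := lower_mem_of_upper_mem hU hk hk10
    intro x hx
    have hx' : z⁻¹ * x * z ∈ H.map (MulAut.conj z⁻¹).toMonoidHom :=
      SL_le_of_unipotents hU hLow _ (by rw [map_mul, map_mul, map_inv, hx, mul_one, inv_mul_cancel])
    rw [mem_map_conj_inv_iff] at hx'
    have e : z * (z⁻¹ * x * z) * z⁻¹ = x := by group
    rwa [e] at hx'

/-- **No level-one witness when `p ∣ |H₁|`** (all primes `p ≥ 5`, all `0 < ε ≤ 1`). -/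
theorem no_levelOne_witness_of_dvd₁ (hp5 : 5 ≤ p) {ε : ℝ} (hε : 0 < ε) (hε1 : ε ≤ 1)
    {H₁ H₂ H₃ : Subgroup (GLm p 2)} (htpp : SubgroupTPP H₁ H₂ H₃) (h₁ : p ∣ Nat.card H₁)
    (hdesign : ∃ c : Mat p 2 → ℂ, (∀ M, 1 < M.rank → c M = 0) ∧
      (∑ M, c M * ZMod.stdAddChar (Matrix.trace (M * ((1 : GLm p 2) : Mat p 2)))) = 1 ∧
      ∀ a ∈ H₁, ∀ b ∈ H₂, ∀ g ∈ H₃, a * b * g ≠ 1 →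
        (∑ M, c M *
          ZMod.stdAddChar (Matrix.trace (M * ((a * b * g : GLm p 2) : Mat p 2)))) = 0) :
    ¬ budget p 2 1 (2 + ε) <
      ((Nat.card H₁ * Nat.card H₂ * Nat.card H₃ : ℕ) : ℝ) ^ ((2 + ε) / 3) := by
  rcases SL_or_borel_of_dvd h₁ with hSL | hframe
  · exact no_levelOne_witness_SL_member (by omega) hε hε1 htpp (Or.inl hSL)
  · exact no_levelOne_witness_borel_first hp5 hε hε1 htpp hframe hdesign

/-- **No level-one witness when `p ∣ |H₂|`** (all primes `p ≥ 5`, all `0 < ε ≤ 1`). -/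
theorem no_levelOne_witness_of_dvd₂ (hp5 : 5 ≤ p) {ε : ℝ} (hε : 0 < ε) (hε1 : ε ≤ 1)
    {H₁ H₂ H₃ : Subgroup (GLm p 2)} (htpp : SubgroupTPP H₁ H₂ H₃) (h₂ : p ∣ Nat.card H₂)
    (hdesign : ∃ c : Mat p 2 → ℂ, (∀ M, 1 < M.rank → c M = 0) ∧
      (∑ M, c M * ZMod.stdAddChar (Matrix.trace (M * ((1 : GLm p 2) : Mat p 2)))) = 1 ∧
      ∀ a ∈ H₁, ∀ b ∈ H₂, ∀ g ∈ H₃, a * b * g ≠ 1 →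
        (∑ M, c M *
          ZMod.stdAddChar (Matrix.trace (M * ((a * b * g : GLm p 2) : Mat p 2)))) = 0) :
    ¬ budget p 2 1 (2 + ε) <
      ((Nat.card H₁ * Nat.card H₂ * Nat.card H₃ : ℕ) : ℝ) ^ ((2 + ε) / 3) := by
  rcases SL_or_borel_of_dvd h₂ with hSL | hframe
  · exact no_levelOne_witness_SL_member (by omega) hε hε1 htpp (Or.inr (Or.inl hSL))
  · exact no_levelOne_witness_borel_middle hp5 hε hε1 htpp hframe hdesign

/-- **No level-one witness when `p ∣ |H₃|`** (all primes `p ≥ 5`, all `0 < ε ≤ 1`). -/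
theorem no_levelOne_witness_of_dvd₃ (hp5 : 5 ≤ p) {ε : ℝ} (hε : 0 < ε) (hε1 : ε ≤ 1)
    {H₁ H₂ H₃ : Subgroup (GLm p 2)} (htpp : SubgroupTPP H₁ H₂ H₃) (h₃ : p ∣ Nat.card H₃)
    (hdesign : ∃ c : Mat p 2 → ℂ, (∀ M, 1 < M.rank → c M = 0) ∧
      (∑ M, c M * ZMod.stdAddChar (Matrix.trace (M * ((1 : GLm p 2) : Mat p 2)))) = 1 ∧
      ∀ a ∈ H₁, ∀ b ∈ H₂, ∀ g ∈ H₃, a * b * g ≠ 1 →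
        (∑ M, c M *
          ZMod.stdAddChar (Matrix.trace (M * ((a * b * g : GLm p 2) : Mat p 2)))) = 0) :
    ¬ budget p 2 1 (2 + ε) <
      ((Nat.card H₁ * Nat.card H₂ * Nat.card H₃ : ℕ) : ℝ) ^ ((2 + ε) / 3) := by
  rcases SL_or_borel_of_dvd h₃ with hSL | hframe
  · exact no_levelOne_witness_SL_member (by omega) hε hε1 htpp (Or.inr (Or.inr hSL))
  · exact no_levelOne_witness_borel_last hp5 hε hε1 htpp hframe hdesign

/-- **THE `p`-MEMBER LAW** (all primes `p ≥ 5`, all `0 < ε ≤ 1`): a subgroup-TPP triple of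
`GL₂(𝔽_p)` with a level-one identity design satisfying the crux inequality has all three members
of order prime to `p`.  The `(2,1)` cell of `SubgroupIdentityDesigns` is thereby reduced, for
`p ≥ 5`, to `p`-free triples. -/
theorem coprime_of_levelOne_witness (hp5 : 5 ≤ p) {ε : ℝ} (hε : 0 < ε) (hε1 : ε ≤ 1)
    {H₁ H₂ H₃ : Subgroup (GLm p 2)} (htpp : SubgroupTPP H₁ H₂ H₃)
    (hdesign : ∃ c : Mat p 2 → ℂ, (∀ M, 1 < M.rank → c M = 0) ∧
      (∑ M, c M * ZMod.stdAddChar (Matrix.trace (M * ((1 : GLm p 2) : Mat p 2)))) = 1 ∧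
      ∀ a ∈ H₁, ∀ b ∈ H₂, ∀ g ∈ H₃, a * b * g ≠ 1 →
        (∑ M, c M *
          ZMod.stdAddChar (Matrix.trace (M * ((a * b * g : GLm p 2) : Mat p 2)))) = 0)
    (hwit : budget p 2 1 (2 + ε) <
      ((Nat.card H₁ * Nat.card H₂ * Nat.card H₃ : ℕ) : ℝ) ^ ((2 + ε) / 3)) :
    ¬ p ∣ Nat.card H₁ ∧ ¬ p ∣ Nat.card H₂ ∧ ¬ p ∣ Nat.card H₃ :=
  ⟨fun h => no_levelOne_witness_of_dvd₁ hp5 hε hε1 htpp h hdesign hwit,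
    fun h => no_levelOne_witness_of_dvd₂ hp5 hε hε1 htpp h hdesign hwit,
    fun h => no_levelOne_witness_of_dvd₃ hp5 hε hε1 htpp h hdesign hwit⟩

end PMemberLaw

end Summit.MatrixMultiplication.MatrixMultiplication.Theorems.SubgroupIdentityDesigns.Negative

end
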